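import Mathlib.RingTheory.MvPolynomial.Basic
import Mathlib.Algebra.MvPolynomial.Degrees
import Mathlib.Algebra.MvPolynomial.CommRing
import Mathlib.Algebra.Algebra.Hom
import Mathlib.GroupTheory.Perm.Basic
import Mathlib.Algebra.BigOperators.Ring.Finset
import Literature.Computability.Complexity.SumOfSquaresRefutation
import HarnessLib

/-!
# Symmetry reduction for static Positivstellensatz refutations: invariant certificates suffice

Topic `Literature/Computability/Complexity`, next to `SumOfSquaresRefutation.lean`
(`HasSOSRefutation S d`: `Σ_l q_l² + Σ_e g_e · S e = -1`, `deg q_l ≤ d`, `deg (g_e · S e) ≤ 2d`).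

**Gatermann–Parrilo symmetry reduction, at the level of certificates.** Let a finite group `G`
act on the polynomial ring `K[X_σ]` by `K`-algebra endomorphisms `ρ_h` that do not raise the
total degree (e.g. permutations of the variables, sign changes `X_s ↦ ±X_s`, and more generally
linear substitutions), and suppose the system of equations `S : ι → K[X_σ]` is permuted by the
action: `ρ_h (S e) = S (π_h e)` for a permutation action `π` of `G` on the index set. If `|G|` is
invertible in `K` and `S` has a static Positivstellensatz refutation of half-degree `d`, then it
has one of the same half-degree which is `G`-INVARIANT: the sum-of-squares part `Σ_l q_l²` is fixed
by every `ρ_h` and the multipliers are equivariant, `ρ_h (g_e) = g_{π_h e}`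
(`HasSOSRefutation.exists_invariant`). The proof is the Reynolds average of Gatermann–Parrilo 2004,
Thm. 3.3 (an invariant SDP has an invariant feasible point of the same value, obtained by
averaging over the group), written out on the certificate: average the identity
`-1 = Σ q_l² + Σ g_e S_e` over its `G`-translates; `(1/|G|) Σ_h (ρ_h q_l)²` is again a sum of
squares — of the polynomials `ρ_h q_l / |G|`, each repeated `|G|` times, so no square roots are
needed — and the averaged multipliers are equivariant by reindexing `h ↦ kh`.

Purpose (route MatrixMultiplication/BrentRefutationDepth, "the symmetry-reduction soundness lemma
(invariant certificates suffice)"): searches for SOS certificates of Brent systems restrict the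
Gram matrix to the commutant of the finite symmetry group (`S_r` permuting the `r` products, sign
changes, signed permutation sandwiches); this lemma says that restriction loses nothing, so a
negative outcome of the reduced search is a genuine degree lower bound. Soundness of any found
certificate needs no symmetry (`HasSOSRefutation.no_common_zero`).

## References

* K. Gatermann, P. A. Parrilo, *Symmetry groups, semidefinite programs, and sums of squares*,
  J. Pure Appl. Algebra 192 (2004) 95–128, Thm. 3.3 (group average / Reynolds operator) and §5
  (invariant sums of squares). [GatermannParrilo2004]
* D. Grigoriev, *Complexity of Positivstellensatz proofs for the knapsack*, Comput. Complexity 10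
  (2001), Def. 0.5 (static refutations). [Grigoriev2001]
-/

noncomputable section

open MvPolynomial Finset

namespace Literature.Computability.Complexity

universe u v w x

variable {ι : Type u} {σ : Type v} {K : Type w} {G : Type x} [Field K] [Group G]

/-! ### The Reynolds sum of an action by algebra endomorphisms -/

section Reynolds

variable [Fintype G] (ρ : G →* (MvPolynomial σ K →ₐ[K] MvPolynomial σ K))

/-- The (unnormalised) Reynolds sum `Σ_{h ∈ G} ρ_h p` of a polynomial under an action of a finite
group by algebra endomorphisms. [cite: GatermannParrilo2004, Thm. 3.3] -/
def reynoldsSum (p : MvPolynomial σ K) : MvPolynomial σ K :=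
  ∑ h, ρ h p

/-- The Reynolds sum is fixed by the action (reindex `h ↦ k h`).
[cite: GatermannParrilo2004, Thm. 3.3] -/
theorem map_reynoldsSum (k : G) (p : MvPolynomial σ K) :
    ρ k (reynoldsSum ρ p) = reynoldsSum ρ p := by
  unfold reynoldsSum
  rw [map_sum]
  simp_rw [← AlgHom.mul_apply, ← map_mul]
  exact Fintype.sum_bijective (fun h => k * h) (Group.mulLeft_bijective k) _ _ fun _ => rfl

/-- The Reynolds sum is additive. [folklore] -/
theorem reynoldsSum_add (p p' : MvPolynomial σ K) :
    reynoldsSum ρ (p + p') = reynoldsSum ρ p + reynoldsSum ρ p' := by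
  simp [reynoldsSum, map_add, sum_add_distrib]

/-- The Reynolds sum of a constant is `|G|` times the constant. [folklore] -/
theorem reynoldsSum_C (c : K) : reynoldsSum ρ (C c) = (Fintype.card G : MvPolynomial σ K) * C c := by
  simp [reynoldsSum, Finset.card_univ]

end Reynolds

/-! ### Invariant certificates suffice -/

/-- Re-indexing a finite family of squares by `Fin m` (`m` = the cardinality of the index type):
the sum of squares and the degree bound are unchanged. [folklore] -/
theorem exists_fin_sum_mul_self_eq {α : Type*} [Fintype α] {d : ℕ} (q : α → MvPolynomial σ K)
    (hq : ∀ a, (q a).totalDegree ≤ d) :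
    ∃ (m : ℕ) (q' : Fin m → MvPolynomial σ K),
      (∀ l, (q' l).totalDegree ≤ d) ∧ (∑ l, q' l * q' l) = ∑ a, q a * q a :=
  ⟨Fintype.card α, fun l => q ((Fintype.equivFin α).symm l), fun _ => hq _,
    Fintype.sum_equiv (Fintype.equivFin α).symm _ _ fun _ => rfl⟩

/-- **Certificates with squares indexed by any finite type**: a static SOS refutation may be given
with its squares indexed by an arbitrary finite type (as certificate generators produce them);
it is a `HasSOSRefutation` of the same half-degree. [cite: Grigoriev2001, Def. 0.5] -/
theorem HasSOSRefutation.of_fintype [Fintype ι] {α : Type*} [Fintype α]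
    {S : ι → MvPolynomial σ K} {d : ℕ} (q : α → MvPolynomial σ K) (g : ι → MvPolynomial σ K)
    (hq : ∀ a, (q a).totalDegree ≤ d) (hg : ∀ e, (g e * S e).totalDegree ≤ 2 * d)
    (hsum : (∑ a, q a * q a) + ∑ e, g e * S e = -1) : HasSOSRefutation S d := by
  obtain ⟨m, q', hq', hsq⟩ := exists_fin_sum_mul_self_eq q hq
  exact ⟨m, q', g, hq', hg, by rw [hsq, hsum]⟩

/-- **Invariant Positivstellensatz certificates suffice** (Reynolds average, after
Gatermann–Parrilo 2004, Thm. 3.3). Let the finite group `G` act on `K[X_σ]` by `K`-algebra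
endomorphisms `ρ_h` not raising total degrees, permuting the system: `ρ_h (S e) = S (π_h e)`, with
`|G| ≠ 0` in `K`. If `S` has a static SOS refutation of half-degree `d`, then it has one of
half-degree `d` whose sum-of-squares part is `ρ`-invariant and whose multipliers are
`π`-equivariant. [cite: GatermannParrilo2004, Thm. 3.3] -/
theorem HasSOSRefutation.exists_invariant [Fintype G] [Fintype ι]
    {S : ι → MvPolynomial σ K} {d : ℕ}
    (ρ : G →* (MvPolynomial σ K →ₐ[K] MvPolynomial σ K)) (π : G →* Equiv.Perm ι)
    (hdeg : ∀ (h : G) (p : MvPolynomial σ K), (ρ h p).totalDegree ≤ p.totalDegree)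
    (hS : ∀ (h : G) (e : ι), ρ h (S e) = S (π h e))
    (hcard : (Fintype.card G : K) ≠ 0) (H : HasSOSRefutation S d) :
    ∃ (m : ℕ) (q : Fin m → MvPolynomial σ K) (g : ι → MvPolynomial σ K),
      (∀ l, (q l).totalDegree ≤ d) ∧ (∀ e, (g e * S e).totalDegree ≤ 2 * d) ∧
        (∑ l, q l * q l) + ∑ e, g e * S e = -1 ∧
        (∀ h, ρ h (∑ l, q l * q l) = ∑ l, q l * q l) ∧
        (∀ h e, ρ h (g e) = g (π h e)) := by
  classical
  obtain ⟨m, q, g, hq, hg, hsum⟩ := H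
  set N : ℕ := Fintype.card G with hNdef
  set c : K := (N : K)⁻¹ with hcdef
  have hcN : c * (N : K) = 1 := inv_mul_cancel₀ hcard
  -- the averaged squares, indexed by `G × Fin m × G` (the last factor repeats each square |G| times)
  let q' : G × Fin m × G → MvPolynomial σ K := fun x => c • ρ x.1 (q x.2.1)
  -- the averaged multipliers
  let g' : ι → MvPolynomial σ K := fun e => c • ∑ h, ρ h (g ((π h)⁻¹ e))
  -- (1) the SOS part is `c •` the Reynolds sum of the original SOS part
  have hSOS : (∑ x, q' x * q' x) = c • reynoldsSum ρ (∑ l, q l * q l) := by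
    have h1 : ∀ x : G × Fin m × G, q' x * q' x = (c * c) • ρ x.1 (q x.2.1 * q x.2.1) := by
      intro x
      simp only [q', map_mul, smul_mul_smul_comm]
    simp_rw [h1]
    rw [Fintype.sum_prod_type]
    simp_rw [Fintype.sum_prod_type (f := fun y : Fin m × G => (c * c) • (ρ _) (q y.1 * q y.1)),
      Finset.sum_const, Finset.card_univ]
    rw [reynoldsSum, Finset.smul_sum]
    refine Finset.sum_congr rfl fun h _ => ?_
    rw [map_sum, Finset.smul_sum]
    refine Finset.sum_congr rfl fun l _ => ?_
    rw [← hNdef, ← Nat.cast_smul_eq_nsmul K, smul_smul,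
      show (N : K) * (c * c) = c by rw [← mul_assoc, mul_comm (N : K), hcN, one_mul]]
  -- (2) the ideal part is `c •` the Reynolds sum of the original ideal part
  have hprod : ∀ e, g' e * S e = c • ∑ h, ρ h (g ((π h)⁻¹ e) * S ((π h)⁻¹ e)) := by
    intro e
    simp only [g', smul_mul_assoc, Finset.sum_mul]
    congr 1
    refine Finset.sum_congr rfl fun h _ => ?_
    rw [map_mul, hS, ← map_inv, ← Equiv.Perm.mul_apply, ← map_mul, mul_inv_cancel, map_one,
      Equiv.Perm.one_apply]
  have hIdeal : (∑ e, g' e * S e) = c • reynoldsSum ρ (∑ e, g e * S e) := by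
    simp_rw [hprod]
    rw [← Finset.smul_sum, Finset.sum_comm, reynoldsSum]
    congr 1
    refine Finset.sum_congr rfl fun h _ => ?_
    rw [map_sum]
    exact Fintype.sum_equiv ((π h)⁻¹) _ _ fun _ => rfl
  -- (3) assemble
  obtain ⟨m', q'', hq'', hsq⟩ := exists_fin_sum_mul_self_eq (d := d) q'
    (fun x => (totalDegree_smul_le _ _).trans ((hdeg _ _).trans (hq _)))
  refine ⟨m', q'', g', hq'', fun e => ?_, ?_, fun h => ?_, fun h e => ?_⟩
  · rw [hprod]
    refine (totalDegree_smul_le _ _).trans ((totalDegree_finsetSum _ _).trans ?_)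
    exact Finset.sup_le fun h _ => (hdeg _ _).trans (hg _)
  · rw [hsq, hSOS, hIdeal, ← smul_add, ← reynoldsSum_add, hsum,
      show (-1 : MvPolynomial σ K) = C (-1) by simp, reynoldsSum_C, ← hNdef, smul_eq_C_mul,
      ← mul_assoc, ← C_eq_coe_nat, ← C_mul, hcN]
    simp
  · rw [hsq, hSOS, map_smul, map_reynoldsSum]
  · simp only [g', map_smul, map_sum]
    congr 1
    simp_rw [← AlgHom.mul_apply, ← map_mul]
    refine Fintype.sum_bijective (fun k => h * k) (Group.mulLeft_bijective h) _ _ fun k => ?_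
    simp only [map_mul, mul_inv_rev, Equiv.Perm.mul_apply, Equiv.Perm.coe_inv,
      Equiv.symm_apply_apply]

/-! ### The case of a permutation action on the variables -/

/-- The action of a group on `K[X_σ]` through a permutation action `θ : G →* Perm σ` on the
variables, `h ↦ rename (θ h)` (a `K`-algebra endomorphism; `rename` is functorial). The case of
the Brent systems: `S_r` permuting the `r` products. [folklore] -/
def renameAction (θ : G →* Equiv.Perm σ) : G →* (MvPolynomial σ K →ₐ[K] MvPolynomial σ K) where
  toFun h := rename (θ h)
  map_one' := by
    apply AlgHom.ext
    intro p
    simp [rename_id]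
  map_mul' h k := by
    apply AlgHom.ext
    intro p
    simp [rename_rename, Equiv.Perm.coe_mul]

/-- `renameAction θ h` is `rename (θ h)`. [folklore] -/
@[simp] theorem renameAction_apply (θ : G →* Equiv.Perm σ) (h : G) (p : MvPolynomial σ K) :
    renameAction (K := K) θ h p = rename (θ h) p := rfl

/-- **Invariant certificates suffice — permutations of the variables.** If a finite group permutes
the variables (`θ`) and thereby the equations (`rename (θ h) (S e) = S (π h e)`), and `|G| ≠ 0` in
`K`, then a static SOS refutation of half-degree `d` can be taken with `θ`-invariant sum of squares
and `π`-equivariant multipliers (`HasSOSRefutation.exists_invariant` for `renameAction θ`;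
`rename` preserves total degree). [cite: GatermannParrilo2004, Thm. 3.3] -/
theorem HasSOSRefutation.exists_invariant_rename [Fintype G] [Fintype ι]
    {S : ι → MvPolynomial σ K} {d : ℕ}
    (θ : G →* Equiv.Perm σ) (π : G →* Equiv.Perm ι)
    (hS : ∀ (h : G) (e : ι), rename (θ h) (S e) = S (π h e))
    (hcard : (Fintype.card G : K) ≠ 0) (H : HasSOSRefutation S d) :
    ∃ (m : ℕ) (q : Fin m → MvPolynomial σ K) (g : ι → MvPolynomial σ K),
      (∀ l, (q l).totalDegree ≤ d) ∧ (∀ e, (g e * S e).totalDegree ≤ 2 * d) ∧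
        (∑ l, q l * q l) + ∑ e, g e * S e = -1 ∧
        (∀ h, rename (θ h) (∑ l, q l * q l) = ∑ l, q l * q l) ∧
        (∀ h e, rename (θ h) (g e) = g (π h e)) := by
  have h := H.exists_invariant (renameAction θ) π (fun h p => totalDegree_rename_le _ _)
    (fun h e => by simpa using hS h e) hcard
  simpa using h

end Literature.Computability.Complexity

end
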